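import Summits.HubbardSuperconductivity.HubbardSuperconductivity.Theorems.AnisotropyChordTransferFibre3B1Weighted
import Summits.HubbardSuperconductivity.HubbardSuperconductivity.Theorems.AnisotropyChordTransferFibre3B1Cells
import Summits.HubbardSuperconductivity.HubbardSuperconductivity.Theorems.AnisotropyChordTransferFibre3RowDLoopSums

/-!
# Route `AnisotropyChord` / H0 rotor rung, LEVEL 2 family B1: the WEIGHTED-UPPER bracket of the two-gradient
three-propagator loop (row D Stage 2, the `(t,t,t)` = `SSS` N-family)

Row D (KT-2a″) Stage 1/1.5 of the route lead (`…RowDLoopKit/…LoopSums/…LoopTables/…LoopW`, p1 g30/g31) majorises the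
`SSS` N-loop `Σ_p g(ℓ₀p)·(w_e g)(ℓ₁p)·(w_{e′} g)(ℓ₂p)` (`g = 1/(2ε − λ₂)`, gradient weight `w_e(q) = ‖1 − conj(phase q ē)‖`)
by the pointwise zone step `(w g)² ≤ c·g` and Cauchy–Schwarz: `≤ c·S₂` (`c = c_Z ≈ 2.6` resp. `c_W ≈ 1.03`) — the family that
carries 95 % of the certified row-D majorant at `ν = .03` (p1 g30 FINDINGS).  ROWD-DESIGN-g29 §3(a) / p1 g30 FINAL NEXT (5) ask for
the Stage-2 replacement: a WEIGHTED-UPPER B1 bracket that keeps the `θ²`-smallness of the two weights on the window.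
THIS FILE + its sibling `…Fibre3B1WLoopBracket` prove it, L-uniformly, for the generic object with integer shifts `s₀` (plain),
`s₁, s₂` (weighted along `e₁, e₂ ∈ E4`):
  ★ `wloop_upper` (sibling):  for `θ = 2π/L ≤ θ₀`, `θ₀K ≤ π/2`, `|s_i|∞ ≤ S`, `2 + 2S ≤ K`, `0 ≤ ν < 4/π²`,
  `θ⁴ · Σ_k g(k+s₀)·(w_{e₁}g)(k+s₁)·(w_{e₂}g)(k+s₂)  ≤  hiSumW ν θ₀ K S s e  +  c_Z(ν) · tailConst ν (K − 2S) 2`,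
  `hiSumW = Σ_{p ∈ idx} |(p+s₁)·e₁|·|(p+s₂)·e₂| · Π_i (W_{θ₀}(p+s_i) − ν)^{−1}` (both pieces L-INDEPENDENT).
THIS FILE: the objects `wloopSum`, `sh3`, `wWeight`, `hiSumW`, `tailG`, the monotonicity `hiSumW_mono`, `cZ_mono`, and the heart
of the proof, the POINTWISE domination ★ `wloop_pointwise`: a WINDOW momentum has `w_{e_i} ≤ θ|(rep k + s_i)·e_i|`
(`RowD.norm_wt_le`) and `θ²g ≤ X̄ = 1/(W_{θ₀} − ν)` factorwise (`Xf_window`), so `θ⁴·g₀(w₁g₁)(w₂g₂) ≤ |m₁·e₁||m₂·e₂|·X̄₀X̄₁X̄₂`;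
a momentum with a vanishing factor contributes `0`; a TAIL momentum (every shifted representative off `zWindow (K − 2S)`,
`rep_add_mem_tail`) keeps TWO propagators: `(w_ig_i)² ≤ c_Z g_i` (`RowD.wt_gres_sq_le`) gives `(w₁g₁)(w₂g₂) ≤ ½c_Z(g₁ + g₂)`, then
`X₀X_j ≤ ½(X₀² + X_j²)` and Jordan (`Xf_pow_tail`, `n = 2`) send everything to the one-propagator squared tail `tailG`, summed by
`tail_majorant_sum_le` in the sibling — the tail is `O(θ⁻⁴)/K′²`; a «plain» tail `|w| ≤ 2` would be `O(θ⁻⁶)` and NOT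
L-uniform.  The special case `s₁ = s₂ = 0`, `e₁ = e₂ = e`, `s₀ = r` is `WS(e,r) = Σ_q 2(1 − cos θq·e) g(q)² g(q+r)` of p1's
NEXT (5); the Cauchy–Schwarz corollaries in the affine-leg language of `…RowDLoopSums` and the exact-integer kernel evaluator
are sibling modules.
Prover seat `hubbard-h0-rotor-p2` g7; helper for piece A = stmt-HubbardSuperconductivity-23918 of rung 19089
(`--supports`, helper class).  Nothing here proves superconductivity in the Hubbard model; helper lemmas of ONE conditional
reduction (the GM₃ ∀L certificate, Level-2 row D); the rotor TARGET as originally worded stays FALSE (g15 verdict).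
Mathlib + the tree only; no sorry.
-/

set_option linter.dupNamespace false
set_option autoImplicit false

noncomputable section

open scoped BigOperators

namespace Summit.HubbardSuperconductivity.HubbardSuperconductivity.Theorems.AnisotropyChord.Transfer.Fibre3.B1

open L2.N1

variable (L : ℕ) [NeZero L]

/-! ## Objects -/

/-- ★ the two-gradient three-propagator loop sum with integer shifts:
`Σ_k g(k+s₀) · (w_{e₁}(k+s₁) g(k+s₁)) · (w_{e₂}(k+s₂) g(k+s₂))`, `g = gres L λ`, `w_e(q) = ‖1 − conj(phase q ē)‖`. -/
def wloopSum (lam : ℝ) (s₀ s₁ s₂ e₁ e₂ : ℤ × ℤ) : ℝ :=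
  ∑ k : Tor L, gres L lam (k + toTor L s₀)
    * (RowD.wnorm L (k + toTor L s₁) (toTor L e₁) * gres L lam (k + toTor L s₁))
    * (RowD.wnorm L (k + toTor L s₂) (toTor L e₂) * gres L lam (k + toTor L s₂))

/-- the three shifts as a `Fin 3` family (for the index set `idx`). -/
def sh3 (s₀ s₁ s₂ : ℤ × ℤ) : Fin 3 → ℤ × ℤ := ![s₀, s₁, s₂]

/-- `sh3 … 0 = s₀`. -/
@[simp] theorem sh3_zero (s₀ s₁ s₂ : ℤ × ℤ) : sh3 s₀ s₁ s₂ 0 = s₀ := rfl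
/-- `sh3 … 1 = s₁`. -/
@[simp] theorem sh3_one (s₀ s₁ s₂ : ℤ × ℤ) : sh3 s₀ s₁ s₂ 1 = s₁ := rfl
/-- `sh3 … 2 = s₂`. -/
@[simp] theorem sh3_two (s₀ s₁ s₂ : ℤ × ℤ) : sh3 s₀ s₁ s₂ 2 = s₂ := rfl

/-- the shift-size hypothesis `|s_i|∞ ≤ S` for the three shifts, from the three componentwise facts. -/
theorem sh3_small (S : ℕ) (s₀ s₁ s₂ : ℤ × ℤ) (h₀ : s₀.1.natAbs ≤ S ∧ s₀.2.natAbs ≤ S)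
    (h₁ : s₁.1.natAbs ≤ S ∧ s₁.2.natAbs ≤ S) (h₂ : s₂.1.natAbs ≤ S ∧ s₂.2.natAbs ≤ S) :
    ∀ i, (sh3 s₀ s₁ s₂ i).1.natAbs ≤ S ∧ (sh3 s₀ s₁ s₂ i).2.natAbs ≤ S := by
  intro i
  fin_cases i
  · exact h₀
  · exact h₁
  · exact h₂

/-- the polynomial window weight `|(p + s₁)·e₁| · |(p + s₂)·e₂|`. -/
def wWeight (s₁ s₂ e₁ e₂ p : ℤ × ℤ) : ℝ :=
  |((qdot (p + s₁) e₁ : ℤ) : ℝ)| * |((qdot (p + s₂) e₂ : ℤ) : ℝ)|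

/-- `wWeight ≥ 0`. -/
theorem wWeight_nonneg (s₁ s₂ e₁ e₂ p : ℤ × ℤ) : 0 ≤ wWeight s₁ s₂ e₁ e₂ p :=
  mul_nonneg (abs_nonneg _) (abs_nonneg _)

/-- ★ the UPPER window sum: `Σ_{p ∈ idx K S s} |(p+s₁)·e₁||(p+s₂)·e₂| · Π_i (W_{θ₀}(p + s_i) − ν)^{−1}`. -/
def hiSumW (ν θ0 : ℝ) (K S : ℕ) (s₀ s₁ s₂ e₁ e₂ : ℤ × ℤ) : ℝ :=
  ∑ p ∈ idx K S (sh3 s₀ s₁ s₂), wWeight s₁ s₂ e₁ e₂ p * ∏ i, (1 / (winE θ0 (p + sh3 s₀ s₁ s₂ i) - ν))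

/-- the one-propagator squared tail majorant beyond `|·|∞ > K′` (the `n = 2` case of the tail function of `B1.prod_Xf_le`). -/
def tailG (ν : ℝ) (K' : ℕ) (k' : Tor L) : ℝ :=
  if rep L k' ∈ zWindow (L / 2) \ zWindow K' then
    (Real.pi ^ 2 / 4 / (((K' : ℝ) + 1) ^ 2 - ν * Real.pi ^ 2 / 4)) ^ (2 - 2)
      * (Real.pi ^ 2 / 4 / (nsq (rep L k') - ν * Real.pi ^ 2 / 4)) ^ 2
  else 0

/-! ## Small lemmas -/

omit [NeZero L] in
/-- a window point lies in the box of the same half-width. [folklore] -/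
theorem mem_box_of_mem_zWindow (K : ℕ) (p : ℤ × ℤ) (hp : p ∈ zWindow K) : p ∈ box K := by
  rw [mem_zWindow_iff] at hp
  rw [mem_box_iff]
  exact hp.2

/-- from `A₁² ≤ c g₁`, `A₂² ≤ c g₂`: `A₁A₂ ≤ ½c(g₁ + g₂)`. [folklore] -/
theorem mul_le_half_of_sq_le {A₁ A₂ g₁ g₂ c : ℝ}
    (h₁ : A₁ ^ 2 ≤ c * g₁) (h₂ : A₂ ^ 2 ≤ c * g₂) :
    A₁ * A₂ ≤ c * (g₁ + g₂) / 2 := by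
  nlinarith [sq_nonneg (A₁ - A₂)]

omit [NeZero L] in
/-- `tailG ≥ 0`. [folklore] -/
theorem tailG_nonneg (ν : ℝ) (K' : ℕ) (k' : Tor L) : 0 ≤ tailG L ν K' k' := by
  unfold tailG
  split_ifs
  · exact mul_nonneg (by rw [show (2 - 2 : ℕ) = 0 from rfl, pow_zero]; exact zero_le_one) (sq_nonneg _)
  · exact le_rfl

/-- `c_Z` is increasing in `ν` below the spectrum. [folklore] -/
theorem cZ_mono (ν ν' : ℝ) (hνν' : ν ≤ ν') (hν' : ν' < 4 / Real.pi ^ 2) : RowD.cZ ν ≤ RowD.cZ ν' := by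
  have hπ := Real.pi_pos
  have h4 : Real.pi ^ 2 * ν' < 4 := by rwa [lt_div_iff₀ (by positivity), mul_comm] at hν'
  unfold RowD.cZ
  apply div_le_div_of_nonneg_left (by positivity) (by linarith)
  nlinarith [mul_le_mul_of_nonneg_left hνν' (sq_nonneg Real.pi)]

/-- the weighted upper window sum is increasing in `ν`. [folklore] -/
theorem hiSumW_mono (ν ν' : ℝ) (hνν' : ν ≤ ν') (hν' : ν' < 4 / Real.pi ^ 2) (θ0 : ℝ) (K S : ℕ)
    (hθ0 : 2 * Real.pi / L ≤ θ0) (hθ0K : θ0 * K ≤ Real.pi / 2) (s₀ s₁ s₂ e₁ e₂ : ℤ × ℤ) :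
    hiSumW ν θ0 K S s₀ s₁ s₂ e₁ e₂ ≤ hiSumW ν' θ0 K S s₀ s₁ s₂ e₁ e₂ := by
  unfold hiSumW
  apply Finset.sum_le_sum
  intro p hp
  rw [mem_idx_iff] at hp
  have hν : ν < 4 / Real.pi ^ 2 := lt_of_le_of_lt hνν' hν'
  apply mul_le_mul_of_nonneg_left _ (wWeight_nonneg _ _ _ _ _)
  apply Finset.prod_le_prod
  · intro i _
    exact div_nonneg zero_le_one (hi_den_pos L ν hν θ0 K hθ0 hθ0K _ (hp.2 i)).le
  · intro i _
    exact one_div_le_one_div_of_le (hi_den_pos L ν' hν' θ0 K hθ0 hθ0K _ (hp.2 i)) (by linarith)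

/-! ## The pointwise domination -/

/-- ★ pointwise: `θ⁴·g₀(w₁g₁)(w₂g₂)` is dominated by the window majorant at `rep k` plus `c_Z` times a convex combination of the
three shifted one-propagator squared tail majorants. -/
theorem wloop_pointwise (θ0 : ℝ) (K S : ℕ) (s₀ s₁ s₂ e₁ e₂ : ℤ × ℤ) (he₁ : e₁ ∈ E4) (he₂ : e₂ ∈ E4)
    (hS : ∀ i, (sh3 s₀ s₁ s₂ i).1.natAbs ≤ S ∧ (sh3 s₀ s₁ s₂ i).2.natAbs ≤ S) (hK : 2 + 2 * S ≤ K)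
    (hθ0 : 2 * Real.pi / L ≤ θ0) (hθ0K : θ0 * K ≤ Real.pi / 2)
    (ν : ℝ) (hν0 : 0 ≤ ν) (hν : ν < 4 / Real.pi ^ 2) (k : Tor L) :
    ((2 * Real.pi / L) ^ 2) ^ 2 *
        (gres L (ν * (2 * Real.pi / L) ^ 2) (k + toTor L s₀)
          * (RowD.wnorm L (k + toTor L s₁) (toTor L e₁) * gres L (ν * (2 * Real.pi / L) ^ 2) (k + toTor L s₁))
          * (RowD.wnorm L (k + toTor L s₂) (toTor L e₂) * gres L (ν * (2 * Real.pi / L) ^ 2) (k + toTor L s₂)))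
      ≤ (if rep L k ∈ idx K S (sh3 s₀ s₁ s₂) then
            wWeight s₁ s₂ e₁ e₂ (rep L k) * ∏ i, (1 / (winE θ0 (rep L k + sh3 s₀ s₁ s₂ i) - ν)) else 0)
        + RowD.cZ ν * ((1 / 2) * tailG L ν (K - 2 * S) (k + toTor L s₀) + (1 / 4) * tailG L ν (K - 2 * S) (k + toTor L s₁)
            + (1 / 4) * tailG L ν (K - 2 * S) (k + toTor L s₂)) := by
  classical
  have h4K := four_mul_le_of_scales L θ0 K hθ0 hθ0K
  have h2K : 2 * K < L := by omega
  have hLpos : (0 : ℝ) < L := by exact_mod_cast Nat.pos_of_ne_zero (NeZero.ne L)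
  have hθpos : 0 < 2 * Real.pi / (L : ℝ) := by positivity
  have hS0 : s₀.1.natAbs ≤ S ∧ s₀.2.natAbs ≤ S := by simpa only [sh3_zero] using hS 0
  have hS1 : s₁.1.natAbs ≤ S ∧ s₁.2.natAbs ≤ S := by simpa only [sh3_one] using hS 1
  have hS2 : s₂.1.natAbs ≤ S ∧ s₂.2.natAbs ≤ S := by simpa only [sh3_two] using hS 2
  -- per-factor facts (stated before the factors are made opaque)
  have hX0 : Xf L ν s₀ k = (2 * Real.pi / L) ^ 2 * gres L (ν * (2 * Real.pi / L) ^ 2) (k + toTor L s₀) := rfl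
  have hX1 : Xf L ν s₁ k = (2 * Real.pi / L) ^ 2 * gres L (ν * (2 * Real.pi / L) ^ 2) (k + toTor L s₁) := rfl
  have hX2 : Xf L ν s₂ k = (2 * Real.pi / L) ^ 2 * gres L (ν * (2 * Real.pi / L) ^ 2) (k + toTor L s₂) := rfl
  have hz₁ : (RowD.wnorm L (k + toTor L s₁) (toTor L e₁) * gres L (ν * (2 * Real.pi / L) ^ 2) (k + toTor L s₁)) ^ 2
      ≤ RowD.cZ ν * gres L (ν * (2 * Real.pi / L) ^ 2) (k + toTor L s₁) :=
    RowD.wt_gres_sq_le L ν hν0 hν (k + toTor L s₁) he₁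
  have hz₂ : (RowD.wnorm L (k + toTor L s₂) (toTor L e₂) * gres L (ν * (2 * Real.pi / L) ^ 2) (k + toTor L s₂)) ^ 2
      ≤ RowD.cZ ν * gres L (ν * (2 * Real.pi / L) ^ 2) (k + toTor L s₂) :=
    RowD.wt_gres_sq_le L ν hν0 hν (k + toTor L s₂) he₂
  have hwt₁ : RowD.wnorm L (k + toTor L s₁) (toTor L e₁)
      ≤ (2 * Real.pi / L) * |((qdot (rep L (k + toTor L s₁)) e₁ : ℤ) : ℝ)| := RowD.norm_wt_le L (k + toTor L s₁) he₁
  have hwt₂ : RowD.wnorm L (k + toTor L s₂) (toTor L e₂)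
      ≤ (2 * Real.pi / L) * |((qdot (rep L (k + toTor L s₂)) e₂ : ℤ) : ℝ)| := RowD.norm_wt_le L (k + toTor L s₂) he₂
  have hg00 : k + toTor L s₀ = 0 → gres L (ν * (2 * Real.pi / L) ^ 2) (k + toTor L s₀) = 0 := by
    intro h; unfold gres; rw [h, if_pos rfl]
  have hg10 : k + toTor L s₁ = 0 → gres L (ν * (2 * Real.pi / L) ^ 2) (k + toTor L s₁) = 0 := by
    intro h; unfold gres; rw [h, if_pos rfl]
  have hg20 : k + toTor L s₂ = 0 → gres L (ν * (2 * Real.pi / L) ^ 2) (k + toTor L s₂) = 0 := by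
    intro h; unfold gres; rw [h, if_pos rfl]
  have hg₀0 : 0 ≤ gres L (ν * (2 * Real.pi / L) ^ 2) (k + toTor L s₀) := gres_nonneg L ν hν _
  have hg₁0 : 0 ≤ gres L (ν * (2 * Real.pi / L) ^ 2) (k + toTor L s₁) := gres_nonneg L ν hν _
  have hg₂0 : 0 ≤ gres L (ν * (2 * Real.pi / L) ^ 2) (k + toTor L s₂) := gres_nonneg L ν hν _
  have hw₁0 : 0 ≤ RowD.wnorm L (k + toTor L s₁) (toTor L e₁) := norm_nonneg _
  have hw₂0 : 0 ≤ RowD.wnorm L (k + toTor L s₂) (toTor L e₂) := norm_nonneg _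
  -- opaque names
  set t : ℝ := (2 * Real.pi / L) ^ 2 with ht
  set g₀ : ℝ := gres L (ν * t) (k + toTor L s₀) with hg₀
  set g₁ : ℝ := gres L (ν * t) (k + toTor L s₁) with hg₁
  set g₂ : ℝ := gres L (ν * t) (k + toTor L s₂) with hg₂
  set w₁ : ℝ := RowD.wnorm L (k + toTor L s₁) (toTor L e₁) with hw₁
  set w₂ : ℝ := RowD.wnorm L (k + toTor L s₂) (toTor L e₂) with hw₂
  clear_value g₀ g₁ g₂ w₁ w₂
  have htpos : 0 < t := by rw [ht]; positivity
  have hθt : (2 * Real.pi / (L : ℝ)) = Real.sqrt t := by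
    rw [ht, Real.sqrt_sq hθpos.le]
  -- nonnegativity of the two majorants
  have hG₀0 := tailG_nonneg L ν (K - 2 * S) (k + toTor L s₀)
  have hG₁0 := tailG_nonneg L ν (K - 2 * S) (k + toTor L s₁)
  have hG₂0 := tailG_nonneg L ν (K - 2 * S) (k + toTor L s₂)
  have hcZ : 0 ≤ RowD.cZ ν := (RowD.cZ_pos hν).le
  have hT0 : 0 ≤ RowD.cZ ν * ((1 / 2) * tailG L ν (K - 2 * S) (k + toTor L s₀)
      + (1 / 4) * tailG L ν (K - 2 * S) (k + toTor L s₁) + (1 / 4) * tailG L ν (K - 2 * S) (k + toTor L s₂)) :=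
    mul_nonneg hcZ (by linarith)
  have hW0 : 0 ≤ (if rep L k ∈ idx K S (sh3 s₀ s₁ s₂) then
      wWeight s₁ s₂ e₁ e₂ (rep L k) * ∏ i, (1 / (winE θ0 (rep L k + sh3 s₀ s₁ s₂ i) - ν)) else 0) := by
    split_ifs with hp
    · rw [mem_idx_iff] at hp
      exact mul_nonneg (wWeight_nonneg _ _ _ _ _) (Finset.prod_nonneg fun i _ =>
        div_nonneg zero_le_one (hi_den_pos L ν hν θ0 K hθ0 hθ0K _ (hp.2 i)).le)
    · exact le_rfl
  by_cases hA : ∀ i, rep L k + sh3 s₀ s₁ s₂ i ∈ zWindow K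
  · -- WINDOW POINT
    have hA0 : rep L k + s₀ ∈ zWindow K := by simpa only [sh3_zero] using hA 0
    have hA1 : rep L k + s₁ ∈ zWindow K := by simpa only [sh3_one] using hA 1
    have hA2 : rep L k + s₂ ∈ zWindow K := by simpa only [sh3_two] using hA 2
    have hidx : rep L k ∈ idx K S (sh3 s₀ s₁ s₂) := by
      rw [mem_idx_iff, mem_box_iff]
      refine ⟨?_, hA⟩
      have h0 := hA0
      rw [mem_zWindow_iff] at h0
      obtain ⟨-, ⟨h1a, h1b⟩, ⟨h2a, h2b⟩⟩ := h0
      have hs1 := hS0.1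
      have hs2 := hS0.2
      simp only [Prod.fst_add, Prod.snd_add] at h1a h1b h2a h2b
      refine ⟨⟨?_, ?_⟩, ⟨?_, ?_⟩⟩ <;> push_cast <;> omega
    rw [if_pos hidx]
    -- factorwise window bounds
    set Y₀ : ℝ := 1 / (winE θ0 (rep L k + s₀) - ν) with hY₀
    set Y₁ : ℝ := 1 / (winE θ0 (rep L k + s₁) - ν) with hY₁
    set Y₂ : ℝ := 1 / (winE θ0 (rep L k + s₂) - ν) with hY₂
    have hprod : (∏ i, (1 / (winE θ0 (rep L k + sh3 s₀ s₁ s₂ i) - ν))) = Y₀ * Y₁ * Y₂ := by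
      rw [Fin.prod_univ_three]
      simp only [sh3_zero, sh3_one, sh3_two, hY₀, hY₁, hY₂]
    have hY0le : t * g₀ ≤ Y₀ := by
      rw [← hX0]
      exact Xf_window L ν hν θ0 K hθ0 hθ0K s₀ k (rep L k + s₀) hA0 (by unfold rep; exact toTor_rep_add L k _)
    have hY1le : t * g₁ ≤ Y₁ := by
      rw [← hX1]
      exact Xf_window L ν hν θ0 K hθ0 hθ0K s₁ k (rep L k + s₁) hA1 (by unfold rep; exact toTor_rep_add L k _)
    have hY2le : t * g₂ ≤ Y₂ := by
      rw [← hX2]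
      exact Xf_window L ν hν θ0 K hθ0 hθ0K s₂ k (rep L k + s₂) hA2 (by unfold rep; exact toTor_rep_add L k _)
    -- the weights on the window: `w_i ≤ θ |(rep k + s_i)·e_i|`
    have hrep : ∀ s : ℤ × ℤ, rep L k + s ∈ zWindow K → rep L (k + toTor L s) = rep L k + s := by
      intro s hs
      have e : k + toTor L s = toTor L (rep L k + s) := by
        unfold rep; exact toTor_rep_add L k _
      rw [e]
      exact rep_toTor_of_mem_box L K h2K _ (mem_box_of_mem_zWindow K _ hs)
    set m₁ : ℝ := |((qdot (rep L k + s₁) e₁ : ℤ) : ℝ)| with hm₁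
    set m₂ : ℝ := |((qdot (rep L k + s₂) e₂ : ℤ) : ℝ)| with hm₂
    have hwle₁ : w₁ ≤ Real.sqrt t * m₁ := by
      rw [hm₁, ← hθt, ← hrep s₁ hA1]; exact hwt₁
    have hwle₂ : w₂ ≤ Real.sqrt t * m₂ := by
      rw [hm₂, ← hθt, ← hrep s₂ hA2]; exact hwt₂
    have hm₁0 : 0 ≤ m₁ := abs_nonneg _
    have hm₂0 : 0 ≤ m₂ := abs_nonneg _
    have hwt : wWeight s₁ s₂ e₁ e₂ (rep L k) = m₁ * m₂ := rfl
    rw [hprod, hwt]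
    have hsq : Real.sqrt t * Real.sqrt t = t := Real.mul_self_sqrt htpos.le
    -- the chain
    have htg₀ : 0 ≤ t * g₀ := by positivity
    have htg₁ : 0 ≤ t * g₁ := by positivity
    have step1 : t ^ 2 * (g₀ * (w₁ * g₁) * (w₂ * g₂))
        ≤ t ^ 2 * (g₀ * (Real.sqrt t * m₁ * g₁) * (Real.sqrt t * m₂ * g₂)) := by
      apply mul_le_mul_of_nonneg_left _ (by positivity)
      apply mul_le_mul (mul_le_mul_of_nonneg_left (mul_le_mul_of_nonneg_right hwle₁ hg₁0) hg₀0)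
        (mul_le_mul_of_nonneg_right hwle₂ hg₂0) (mul_nonneg hw₂0 hg₂0) (by positivity)
    have step2 : t ^ 2 * (g₀ * (Real.sqrt t * m₁ * g₁) * (Real.sqrt t * m₂ * g₂))
        = m₁ * m₂ * ((t * g₀) * (t * g₁) * ((Real.sqrt t * Real.sqrt t) * g₂)) := by ring
    rw [hsq] at step2
    have step3 : (t * g₀) * (t * g₁) * (t * g₂) ≤ Y₀ * Y₁ * Y₂ := by
      have h01 : (t * g₀) * (t * g₁) ≤ Y₀ * Y₁ := mul_le_mul hY0le hY1le htg₁ (htg₀.trans hY0le)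
      exact mul_le_mul h01 hY2le (by positivity) ((mul_nonneg htg₀ htg₁).trans h01)
    calc t ^ 2 * (g₀ * (w₁ * g₁) * (w₂ * g₂))
        ≤ m₁ * m₂ * ((t * g₀) * (t * g₁) * (t * g₂)) := step1.trans step2.le
      _ ≤ m₁ * m₂ * (Y₀ * Y₁ * Y₂) := mul_le_mul_of_nonneg_left step3 (mul_nonneg hm₁0 hm₂0)
      _ ≤ m₁ * m₂ * (Y₀ * Y₁ * Y₂) + RowD.cZ ν * ((1 / 2) * tailG L ν (K - 2 * S) (k + toTor L s₀)
            + (1 / 4) * tailG L ν (K - 2 * S) (k + toTor L s₁) + (1 / 4) * tailG L ν (K - 2 * S) (k + toTor L s₂)) :=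
          le_add_of_nonneg_right hT0
  · push Not at hA
    obtain ⟨i1, hi1⟩ := hA
    by_cases hZ : g₀ = 0 ∨ g₁ = 0 ∨ g₂ = 0
    · -- A FACTOR VANISHES
      have hzero : t ^ 2 * (g₀ * (w₁ * g₁) * (w₂ * g₂)) = 0 := by
        rcases hZ with h | h | h <;> · rw [h]; ring
      rw [hzero]
      exact add_nonneg hW0 hT0
    · -- TAIL POINT
      push Not at hZ
      obtain ⟨hz0, hz1, hz2⟩ := hZ
      have hne₀ : k + toTor L s₀ ≠ 0 := fun h => hz0 (hg00 h)
      have hne₁ : k + toTor L s₁ ≠ 0 := fun h => hz1 (hg10 h)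
      have hne₂ : k + toTor L s₂ ≠ 0 := fun h => hz2 (hg20 h)
      have hne : ∀ j : Fin 3, k + toTor L (sh3 s₀ s₁ s₂ j) ≠ 0 := by
        intro j
        fin_cases j
        · exact hne₀
        · exact hne₁
        · exact hne₂
      have hne1 : rep L k + sh3 s₀ s₁ s₂ i1 ≠ (0, 0) := by
        intro h
        apply hne i1
        have e := toTor_rep_add L k (sh3 s₀ s₁ s₂ i1)
        unfold rep at h
        rw [h] at e
        rw [e]
        unfold toTor
        simp
      -- every factor is in the tail of its own representative
      have htail : ∀ s : ℤ × ℤ, s.1.natAbs ≤ S ∧ s.2.natAbs ≤ S → k + toTor L s ≠ 0 →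
          Xf L ν s k ^ 2 ≤ tailG L ν (K - 2 * S) (k + toTor L s) := by
        intro s hs hnes
        obtain ⟨hmem, hsq⟩ := rep_add_mem_tail L K S hK h4K k s (sh3 s₀ s₁ s₂ i1) hs (hS i1) hne1 hi1 hnes
        unfold tailG
        rw [if_pos hmem]
        exact Xf_pow_tail L ν hν s k hnes 2 (K - 2 * S) le_rfl hsq
      have hG₀ : (t * g₀) ^ 2 ≤ tailG L ν (K - 2 * S) (k + toTor L s₀) := by
        rw [← hX0]; exact htail s₀ hS0 hne₀
      have hG₁ : (t * g₁) ^ 2 ≤ tailG L ν (K - 2 * S) (k + toTor L s₁) := by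
        rw [← hX1]; exact htail s₁ hS1 hne₁
      have hG₂ : (t * g₂) ^ 2 ≤ tailG L ν (K - 2 * S) (k + toTor L s₂) := by
        rw [← hX2]; exact htail s₂ hS2 hne₂
      -- make the remaining atoms opaque (pure polynomial arithmetic from here)
      set G₀ : ℝ := tailG L ν (K - 2 * S) (k + toTor L s₀) with hG₀def
      set G₁ : ℝ := tailG L ν (K - 2 * S) (k + toTor L s₁) with hG₁def
      set G₂ : ℝ := tailG L ν (K - 2 * S) (k + toTor L s₂) with hG₂def
      set c : ℝ := RowD.cZ ν with hcdef
      clear_value G₀ G₁ G₂ c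
      -- the zone step on the two weighted factors
      have hww : (w₁ * g₁) * (w₂ * g₂) ≤ c * (g₁ + g₂) / 2 := mul_le_half_of_sq_le hz₁ hz₂
      have step1 : t ^ 2 * (g₀ * (w₁ * g₁) * (w₂ * g₂))
          ≤ t ^ 2 * (g₀ * (c * (g₁ + g₂) / 2)) := by
        apply mul_le_mul_of_nonneg_left _ (by positivity)
        rw [mul_assoc]
        exact mul_le_mul_of_nonneg_left hww hg₀0
      have step2 : t ^ 2 * (g₀ * (c * (g₁ + g₂) / 2))
          = c / 2 * ((t * g₀) * (t * g₁) + (t * g₀) * (t * g₂)) := by ring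
      have step3 : (t * g₀) * (t * g₁) + (t * g₀) * (t * g₂)
          ≤ ((t * g₀) ^ 2 + (t * g₁) ^ 2) / 2 + ((t * g₀) ^ 2 + (t * g₂) ^ 2) / 2 := by
        have h1 := two_mul_le_add_sq (t * g₀) (t * g₁)
        have h2 := two_mul_le_add_sq (t * g₀) (t * g₂)
        linarith
      have step4 : ((t * g₀) ^ 2 + (t * g₁) ^ 2) / 2 + ((t * g₀) ^ 2 + (t * g₂) ^ 2) / 2
          ≤ 2 * ((1 / 2) * G₀ + (1 / 4) * G₁
              + (1 / 4) * G₂) := by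
        linarith
      calc t ^ 2 * (g₀ * (w₁ * g₁) * (w₂ * g₂))
          ≤ c / 2 * ((t * g₀) * (t * g₁) + (t * g₀) * (t * g₂)) := step1.trans step2.le
        _ ≤ c / 2 * (2 * ((1 / 2) * G₀
              + (1 / 4) * G₁ + (1 / 4) * G₂)) :=
            mul_le_mul_of_nonneg_left (step3.trans step4) (div_nonneg hcZ zero_le_two)
        _ = c * ((1 / 2) * G₀
              + (1 / 4) * G₁ + (1 / 4) * G₂) := by
            ring
        _ ≤ _ := le_add_of_nonneg_left hW0

end Summit.HubbardSuperconductivity.HubbardSuperconductivity.Theorems.AnisotropyChord.Transfer.Fibre3.B1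

end
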